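import Summits.AtomisticToContinuum.Crystallization.Theorems.ExcessDecayLiouvilleParamArithF

/-!
# Route `ExcessDecayLiouville`: the numerical conditions of the final parameter choice, II (pure arithmetic, G)

Harmonic-replacement architecture for item `ExcessDecay` (stmt-AtomisticToContinuum-9334), nonlinear half.
In the regime `r ≥ L⁴⁰⁰`: the derived shapes of the phase-one outputs and the budgets of phase two (`U⋆, U_max, V⋆`).
All `[folklore]`; pure real inequalities, nothing here closes an item.
-/

namespace Summit.AtomisticToContinuum.Crystallization.Theorems.ExcessDecayLiouville

/-- **Derived shapes of the phase-one outputs** (`K, s, b, Vₐ + s, Λ₁`). [folklore] -/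
theorem derived_shapes {L δ r ε ξn Du K s bT Va Ss S2 Vs : ℝ} (hL : 239000000 ≤ L) (hδ : 0 < δ)
    (hr : L ^ 400 ≤ r) (hε0 : 0 ≤ ε)
    (hSs : Ss ≤ L ^ 3 * ε / r + L / (δ ^ 3 * r ^ 3))
    (hS2 : S2 ≤ L ^ 35 * ε / r ^ 2 + L ^ 253 / (δ ^ 3 * r ^ 4))
    (hVs : Vs ≤ L ^ 3 * ε + L / (δ ^ 3 * r ^ 2))
    (hK : K ≤ 1428 * L ^ 9 * S2) (hs : s ≤ L ^ 13 * Ss) (hbT : bT ≤ 12 * L ^ 8 * Ss)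
    (hVa : Va ≤ L ^ 8 * Vs + (66 / 5) * L ^ 8 * Ss)
    (hξn : ξn ≤ L ^ 2 * ε + L ^ 2 / (δ ^ 3 * r ^ 4)) (hDu : Du ≤ L ^ 30 * ε + L ^ 250 / (δ ^ 3 * r ^ 2)) :
    K ≤ L ^ 45 * ε / r ^ 2 + L ^ 263 / (δ ^ 3 * r ^ 4) ∧ s ≤ L ^ 16 * ε / r + L ^ 14 / (δ ^ 3 * r ^ 3) ∧
    bT ≤ L ^ 13 * ε / r + L ^ 11 / (δ ^ 3 * r ^ 3) ∧ Va + s ≤ L ^ 12 * ε + L ^ 10 / (δ ^ 3 * r ^ 2) ∧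
    210000 * ((25 / 23) * (2 * Du + ξn) + 0) ≤ L ^ 31 * ε + L ^ 251 / (δ ^ 3 * r ^ 2) := by
  have hL1 : (1 : ℝ) ≤ L := by linarith
  have hL0 : (0 : ℝ) < L := by linarith
  have hr0 : 0 < r := lt_of_lt_of_le (by positivity) hr
  have hr1 : 1 ≤ r := le_trans (one_le_pow₀ hL1) hr
  have hδ3 : 0 < δ ^ 3 := by positivity
  have hA : 0 ≤ ε / r := by positivity
  have hB : 0 ≤ 1 / (δ ^ 3 * r ^ 3) := by positivity
  refine ⟨?_, ?_, ?_, ?_, ?_⟩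
  · refine hK.trans ?_
    have h0 : 0 ≤ 1428 * L ^ 9 := by positivity
    refine (mul_le_mul_of_nonneg_left hS2 h0).trans ?_
    have e : 1428 * L ^ 9 * (L ^ 35 * ε / r ^ 2 + L ^ 253 / (δ ^ 3 * r ^ 4)) =
        (1428 * L ^ 44) * (ε / r ^ 2) + (1428 * L ^ 262) * (1 / (δ ^ 3 * r ^ 4)) := by ring
    have e' : L ^ 45 * ε / r ^ 2 + L ^ 263 / (δ ^ 3 * r ^ 4) = L ^ 45 * (ε / r ^ 2) + L ^ 263 * (1 / (δ ^ 3 * r ^ 4)) := by ring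
    rw [e, e']
    have c1 : 1428 * L ^ 44 ≤ L ^ 45 := by
      calc 1428 * L ^ 44 ≤ L * L ^ 44 := mul_le_mul_of_nonneg_right (by linarith) (by positivity)
        _ = L ^ 45 := by ring
    have c2 : 1428 * L ^ 262 ≤ L ^ 263 := by
      calc 1428 * L ^ 262 ≤ L * L ^ 262 := mul_le_mul_of_nonneg_right (by linarith) (by positivity)
        _ = L ^ 263 := by ring
    exact add_le_add (mul_le_mul_of_nonneg_right c1 (by positivity)) (mul_le_mul_of_nonneg_right c2 (by positivity))
  · refine hs.trans ((mul_le_mul_of_nonneg_left hSs (by positivity)).trans (le_of_eq ?_))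
    ring
  · refine hbT.trans ((mul_le_mul_of_nonneg_left hSs (by positivity)).trans ?_)
    have e : 12 * L ^ 8 * (L ^ 3 * ε / r + L / (δ ^ 3 * r ^ 3)) = (12 * L ^ 11) * (ε / r) + (12 * L ^ 9) * (1 / (δ ^ 3 * r ^ 3)) := by ring
    have e' : L ^ 13 * ε / r + L ^ 11 / (δ ^ 3 * r ^ 3) = L ^ 13 * (ε / r) + L ^ 11 * (1 / (δ ^ 3 * r ^ 3)) := by ring
    rw [e, e']
    have hL2 : (12 : ℝ) ≤ L ^ 2 := le_trans (by norm_num) (pow_le_pow_left₀ (by norm_num) hL 2)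
    have c1 : 12 * L ^ 11 ≤ L ^ 13 := by
      calc 12 * L ^ 11 ≤ L ^ 2 * L ^ 11 := mul_le_mul_of_nonneg_right hL2 (by positivity)
        _ = L ^ 13 := by ring
    have c2 : 12 * L ^ 9 ≤ L ^ 11 := by
      calc 12 * L ^ 9 ≤ L ^ 2 * L ^ 9 := mul_le_mul_of_nonneg_right hL2 (by positivity)
        _ = L ^ 11 := by ring
    exact add_le_add (mul_le_mul_of_nonneg_right c1 hA) (mul_le_mul_of_nonneg_right c2 hB)
  · have h1 : Va + s ≤ L ^ 8 * Vs + ((66 / 5) * L ^ 8 + L ^ 13) * Ss := by linarith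
    refine h1.trans ?_
    have h2 : L ^ 8 * Vs + ((66 / 5) * L ^ 8 + L ^ 13) * Ss ≤
        L ^ 8 * (L ^ 3 * ε + L / (δ ^ 3 * r ^ 2)) + ((66 / 5) * L ^ 8 + L ^ 13) * (L ^ 3 * ε / r + L / (δ ^ 3 * r ^ 3)) := by
      gcongr
    refine h2.trans ?_
    have e : L ^ 8 * (L ^ 3 * ε + L / (δ ^ 3 * r ^ 2)) + ((66 / 5) * L ^ 8 + L ^ 13) * (L ^ 3 * ε / r + L / (δ ^ 3 * r ^ 3)) =
        (L ^ 11 + ((66 / 5) * L ^ 11 + L ^ 16) * (1 / r)) * ε + (L ^ 9 + ((66 / 5) * L ^ 9 + L ^ 14) * (1 / r)) * (1 / (δ ^ 3 * r ^ 2)) := by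
      field_simp
    have e' : L ^ 12 * ε + L ^ 10 / (δ ^ 3 * r ^ 2) = L ^ 12 * ε + L ^ 10 * (1 / (δ ^ 3 * r ^ 2)) := by ring
    rw [e, e']
    have k1 : (66 / 5) * L ^ 11 * (1 / r) ≤ 1 := coef_small hL1 hr (by linarith) (by norm_num)
    have k2 : 1 * L ^ 16 * (1 / r) ≤ 1 := coef_small hL1 hr hL1 (by norm_num)
    have k3 : (66 / 5) * L ^ 9 * (1 / r) ≤ 1 := coef_small hL1 hr (by linarith) (by norm_num)
    have k4 : 1 * L ^ 14 * (1 / r) ≤ 1 := coef_small hL1 hr hL1 (by norm_num)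
    have c1 : L ^ 11 + ((66 / 5) * L ^ 11 + L ^ 16) * (1 / r) ≤ L ^ 12 := by
      have : L ^ 11 + 2 ≤ L ^ 12 := by
        have hp : 2 * L ^ 11 ≤ L ^ 12 := by
          calc 2 * L ^ 11 ≤ L * L ^ 11 := mul_le_mul_of_nonneg_right (by linarith) (by positivity)
            _ = L ^ 12 := by ring
        have hq : (2 : ℝ) ≤ L ^ 11 := le_trans (by linarith) (le_self_pow₀ hL1 (by norm_num))
        linarith
      linarith [k1, k2]
    have c2 : L ^ 9 + ((66 / 5) * L ^ 9 + L ^ 14) * (1 / r) ≤ L ^ 10 := by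
      have : L ^ 9 + 2 ≤ L ^ 10 := by
        have hp : 2 * L ^ 9 ≤ L ^ 10 := by
          calc 2 * L ^ 9 ≤ L * L ^ 9 := mul_le_mul_of_nonneg_right (by linarith) (by positivity)
            _ = L ^ 10 := by ring
        have hq : (2 : ℝ) ≤ L ^ 9 := le_trans (by linarith) (le_self_pow₀ hL1 (by norm_num))
        linarith
      linarith [k3, k4]
    exact add_le_add (mul_le_mul_of_nonneg_right c1 hε0) (mul_le_mul_of_nonneg_right c2 (by positivity))
  · have hb : 2 * Du + ξn ≤ (2 * L ^ 30 + L ^ 2) * ε + (2 * L ^ 250 + L ^ 2) * (1 / (δ ^ 3 * r ^ 2)) := by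
      have h4 : L ^ 2 / (δ ^ 3 * r ^ 4) ≤ L ^ 2 * (1 / (δ ^ 3 * r ^ 2)) := by
        rw [mul_one_div, div_le_div_iff₀ (by positivity) (by positivity)]
        have : r ^ 2 ≤ r ^ 4 := pow_le_pow_right₀ hr1 (by norm_num)
        have h' : 0 ≤ L ^ 2 * δ ^ 3 := by positivity
        nlinarith [mul_le_mul_of_nonneg_left this h']
      have e : L ^ 250 / (δ ^ 3 * r ^ 2) = L ^ 250 * (1 / (δ ^ 3 * r ^ 2)) := by ring
      linarith [hDu, hξn, h4, e]
    have e' : L ^ 31 * ε + L ^ 251 / (δ ^ 3 * r ^ 2) = L ^ 31 * ε + L ^ 251 * (1 / (δ ^ 3 * r ^ 2)) := by ring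
    rw [e']
    have c1 : 210000 * (25 / 23) * (2 * L ^ 30 + L ^ 2) ≤ L ^ 31 := by
      have h30 : L ^ 2 ≤ L ^ 30 := pow_le_pow_right₀ hL1 (by norm_num)
      calc 210000 * (25 / 23) * (2 * L ^ 30 + L ^ 2) ≤ 210000 * (25 / 23) * (3 * L ^ 30) := by linarith
        _ ≤ L * L ^ 30 := by
            rw [show 210000 * (25 / 23) * (3 * L ^ 30) = (210000 * (25 / 23) * 3) * L ^ 30 by ring]
            exact mul_le_mul_of_nonneg_right (by linarith) (by positivity)
        _ = L ^ 31 := by ring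
    have c2 : 210000 * (25 / 23) * (2 * L ^ 250 + L ^ 2) ≤ L ^ 251 := by
      have h30 : L ^ 2 ≤ L ^ 250 := pow_le_pow_right₀ hL1 (by norm_num)
      calc 210000 * (25 / 23) * (2 * L ^ 250 + L ^ 2) ≤ 210000 * (25 / 23) * (3 * L ^ 250) := by linarith
        _ ≤ L * L ^ 250 := by
            rw [show 210000 * (25 / 23) * (3 * L ^ 250) = (210000 * (25 / 23) * 3) * L ^ 250 by ring]
            exact mul_le_mul_of_nonneg_right (by linarith) (by positivity)
        _ = L ^ 251 := by ring
    have hF : 0 ≤ 1 / (δ ^ 3 * r ^ 2) := by positivity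
    calc 210000 * ((25 / 23) * (2 * Du + ξn) + 0) = 210000 * (25 / 23) * (2 * Du + ξn) := by ring
      _ ≤ 210000 * (25 / 23) * ((2 * L ^ 30 + L ^ 2) * ε + (2 * L ^ 250 + L ^ 2) * (1 / (δ ^ 3 * r ^ 2))) :=
          mul_le_mul_of_nonneg_left hb (by norm_num)
      _ = (210000 * (25 / 23) * (2 * L ^ 30 + L ^ 2)) * ε + (210000 * (25 / 23) * (2 * L ^ 250 + L ^ 2)) * (1 / (δ ^ 3 * r ^ 2)) := by ring
      _ ≤ L ^ 31 * ε + L ^ 251 * (1 / (δ ^ 3 * r ^ 2)) :=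
          add_le_add (mul_le_mul_of_nonneg_right c1 hε0) (mul_le_mul_of_nonneg_right c2 hF)

/-- **The budgets of phase two in shape form**: `U⋆ ≤ L¹²ε/r + L²³⁷/(δ³r³)`, `U_max ≤ L¹³ε/r + L²³⁸/(δ³r³)`,
`V⋆ ≤ ε/L⁵⁸ + L¹⁶⁷/(δ³r²)`. [folklore] -/
theorem budget_shapes {L δ r ε γ₀ σ₀ Φ ν Du : ℝ} (hL : 239000000 ≤ L) (hδ : 0 < δ) (hr : L ^ 400 ≤ r) (hε0 : 0 ≤ ε)
    (hρ₀hi : σ₀ ^ 2 ≤ r / L ^ 70)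
    (hGU : γ₀ * σ₀ ≤ L ^ 11 * ε / r + L ^ 236 / (δ ^ 3 * r ^ 3))
    (hGV : γ₀ * σ₀ ^ 3 ≤ ε / L ^ 59 + L ^ 166 / (δ ^ 3 * r ^ 2))
    (hΦ0 : 0 ≤ Φ) (hΦ : Φ ≤ 4 * L / (δ ^ 3 * r ^ 4))
    (hν0 : 0 ≤ ν) (hν : ν ≤ 2 * L ^ 32 * ε / r ^ 3 + 3 * L ^ 252 / (δ ^ 3 * r ^ 5))
    (hDu0 : 0 ≤ Du) (hDu : Du ≤ L ^ 30 * ε + L ^ 250 / (δ ^ 3 * r ^ 2)) :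
    2 * (γ₀ * σ₀) + 2 * (σ₀ ^ 2 * (Φ + ν)) ≤ L ^ 12 * ε / r + L ^ 237 / (δ ^ 3 * r ^ 3) ∧
    2 * (γ₀ * σ₀) + 2 * (σ₀ ^ 2 * (Φ + ν)) + Du / r ^ 2 ≤ L ^ 13 * ε / r + L ^ 238 / (δ ^ 3 * r ^ 3) ∧
    2 * vAgg σ₀ γ₀ Φ Du r ≤ ε / L ^ 58 + L ^ 167 / (δ ^ 3 * r ^ 2) := by
  have hL1 : (1 : ℝ) ≤ L := by linarith
  have hL0 : (0 : ℝ) < L := by linarith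
  have hr0 : 0 < r := lt_of_lt_of_le (by positivity) hr
  have hr1 : 1 ≤ r := le_trans (one_le_pow₀ hL1) hr
  have hρ₀0 : 0 ≤ σ₀ ^ 2 := sq_nonneg _
  have hδ3 : 0 < δ ^ 3 := by positivity
  set A := ε / r with hA
  set B := 1 / (δ ^ 3 * r ^ 3) with hB
  have hA0 : 0 ≤ A := by positivity
  have hB0 : 0 ≤ B := by positivity
  -- Ustar
  have t2 : σ₀ ^ 2 * (Φ + ν) ≤ (r / L ^ 70) * (4 * L / (δ ^ 3 * r ^ 4) + (2 * L ^ 32 * ε / r ^ 3 + 3 * L ^ 252 / (δ ^ 3 * r ^ 5))) :=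
    mul_le_mul hρ₀hi (add_le_add hΦ hν) (by positivity) (by positivity)
  have f2 : (r / L ^ 70) * (4 * L / (δ ^ 3 * r ^ 4) + (2 * L ^ 32 * ε / r ^ 3 + 3 * L ^ 252 / (δ ^ 3 * r ^ 5))) =
      (2 * L ^ 32 / L ^ 70 * (1 / r)) * A + (4 * L / L ^ 70 + 3 * L ^ 252 / L ^ 70 * (1 / r)) * B := by
    rw [hA, hB]; field_simp; ring
  have fU : L ^ 11 * ε / r + L ^ 236 / (δ ^ 3 * r ^ 3) = L ^ 11 * A + L ^ 236 * B := by rw [hA, hB]; ring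
  have c1 : 2 * L ^ 32 / L ^ 70 * (1 / r) ≤ 1 := by
    have h1 : 2 * L ^ 32 / L ^ 70 ≤ 1 := by
      rw [div_le_one (by positivity)]
      calc 2 * L ^ 32 ≤ L * L ^ 32 := mul_le_mul_of_nonneg_right (by linarith) (by positivity)
        _ = L ^ 33 := by ring
        _ ≤ L ^ 70 := pow_le_pow_right₀ hL1 (by norm_num)
    have h2 : 1 / r ≤ 1 := by rw [div_le_one hr0]; exact hr1
    calc 2 * L ^ 32 / L ^ 70 * (1 / r) ≤ 1 * 1 := mul_le_mul h1 h2 (by positivity) zero_le_one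
      _ = 1 := one_mul 1
  have c2 : 4 * L / L ^ 70 ≤ 1 := by
    rw [div_le_one (by positivity)]
    calc 4 * L ≤ L * L := mul_le_mul_of_nonneg_right (by linarith) hL0.le
      _ = L ^ 2 := by ring
      _ ≤ L ^ 70 := pow_le_pow_right₀ hL1 (by norm_num)
  have c3 : 3 * L ^ 252 / L ^ 70 * (1 / r) ≤ L ^ 183 := by
    have e : 3 * L ^ 252 / L ^ 70 = (3 * L ^ 182 : ℝ) := by
      rw [div_eq_iff (by positivity)]; ring
    rw [e]
    have h2 : 1 / r ≤ 1 := by rw [div_le_one hr0]; exact hr1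
    calc 3 * L ^ 182 * (1 / r) ≤ 3 * L ^ 182 * 1 := mul_le_mul_of_nonneg_left h2 (by positivity)
      _ ≤ L * L ^ 182 := by rw [mul_one]; exact mul_le_mul_of_nonneg_right (by linarith) (by positivity)
      _ = L ^ 183 := by ring
  have hU : 2 * (γ₀ * σ₀) + 2 * (σ₀ ^ 2 * (Φ + ν)) ≤ L ^ 12 * ε / r + L ^ 237 / (δ ^ 3 * r ^ 3) := by
    have gU : L ^ 12 * ε / r + L ^ 237 / (δ ^ 3 * r ^ 3) = L ^ 12 * A + L ^ 237 * B := by rw [hA, hB]; ring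
    rw [gU]
    rw [fU] at hGU
    have s1 := mul_le_mul_of_nonneg_right c1 hA0
    have s2 := mul_le_mul_of_nonneg_right c2 hB0
    have s3 := mul_le_mul_of_nonneg_right c3 hB0
    have k1 : 2 * L ^ 11 + 2 ≤ L ^ 12 := by
      have : (2 : ℝ) ≤ L ^ 11 := le_trans (by linarith) (le_self_pow₀ hL1 (by norm_num))
      calc 2 * L ^ 11 + 2 ≤ 3 * L ^ 11 := by linarith
        _ ≤ L * L ^ 11 := mul_le_mul_of_nonneg_right (by linarith) (by positivity)
        _ = L ^ 12 := by ring
    have k2 : 2 * L ^ 236 + 2 + 2 * L ^ 183 ≤ L ^ 237 := by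
      have h1 : L ^ 183 ≤ L ^ 236 := pow_le_pow_right₀ hL1 (by norm_num)
      have h2 : (2 : ℝ) ≤ L ^ 236 := le_trans (by linarith) (le_self_pow₀ hL1 (by norm_num))
      calc 2 * L ^ 236 + 2 + 2 * L ^ 183 ≤ 5 * L ^ 236 := by linarith
        _ ≤ L * L ^ 236 := mul_le_mul_of_nonneg_right (by linarith) (by positivity)
        _ = L ^ 237 := by ring
    have s4 := mul_le_mul_of_nonneg_right k1 hA0
    have s5 := mul_le_mul_of_nonneg_right k2 hB0
    linarith [t2, f2, hGU, s1, s2, s3, s4, s5]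
  -- Umax
  have hDur : Du / r ^ 2 ≤ (L ^ 30 * (1 / r)) * A + (L ^ 250 * (1 / r)) * B := by
    have e : (L ^ 30 * ε + L ^ 250 / (δ ^ 3 * r ^ 2)) / r ^ 2 = (L ^ 30 * (1 / r)) * A + (L ^ 250 * (1 / r)) * B := by
      rw [hA, hB]; field_simp
    rw [← e]; exact div_le_div_of_nonneg_right hDu (by positivity)
  have c4 : L ^ 30 * (1 / r) ≤ 1 := by
    have := coef_small (c := (1 : ℝ)) (a := 30) hL1 hr hL1 (by norm_num); simpa using this
  have c5 : L ^ 250 * (1 / r) ≤ 1 := by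
    have := coef_small (c := (1 : ℝ)) (a := 250) hL1 hr hL1 (by norm_num); simpa using this
  have hUm : 2 * (γ₀ * σ₀) + 2 * (σ₀ ^ 2 * (Φ + ν)) + Du / r ^ 2 ≤ L ^ 13 * ε / r + L ^ 238 / (δ ^ 3 * r ^ 3) := by
    have gU : L ^ 12 * ε / r + L ^ 237 / (δ ^ 3 * r ^ 3) = L ^ 12 * A + L ^ 237 * B := by rw [hA, hB]; ring
    have gM : L ^ 13 * ε / r + L ^ 238 / (δ ^ 3 * r ^ 3) = L ^ 13 * A + L ^ 238 * B := by rw [hA, hB]; ring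
    rw [gM]; rw [gU] at hU
    have s1 := mul_le_mul_of_nonneg_right c4 hA0
    have s2 := mul_le_mul_of_nonneg_right c5 hB0
    have k1 : L ^ 12 + 1 ≤ L ^ 13 := by
      have : (1 : ℝ) ≤ L ^ 12 := one_le_pow₀ hL1
      calc L ^ 12 + 1 ≤ 2 * L ^ 12 := by linarith
        _ ≤ L * L ^ 12 := mul_le_mul_of_nonneg_right (by linarith) (by positivity)
        _ = L ^ 13 := by ring
    have k2 : L ^ 237 + 1 ≤ L ^ 238 := by
      have : (1 : ℝ) ≤ L ^ 237 := one_le_pow₀ hL1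
      calc L ^ 237 + 1 ≤ 2 * L ^ 237 := by linarith
        _ ≤ L * L ^ 237 := mul_le_mul_of_nonneg_right (by linarith) (by positivity)
        _ = L ^ 238 := by ring
    have s4 := mul_le_mul_of_nonneg_right k1 hA0
    have s5 := mul_le_mul_of_nonneg_right k2 hB0
    linarith [hU, hDur, s1, s2, s4, s5]
  -- Vstar
  have hV : 2 * vAgg σ₀ γ₀ Φ Du r ≤ ε / L ^ 58 + L ^ 167 / (δ ^ 3 * r ^ 2) := by
    unfold vAgg
    have hρ2 : (σ₀ ^ 2) ^ 2 ≤ (r / L ^ 70) ^ 2 := pow_le_pow_left₀ hρ₀0 hρ₀hi 2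
    have t2 : σ₀ ^ 4 * Φ ≤ (r / L ^ 70) ^ 2 * (4 * L / (δ ^ 3 * r ^ 4)) := by
      calc σ₀ ^ 4 * Φ = (σ₀ ^ 2) ^ 2 * Φ := by ring
        _ ≤ (r / L ^ 70) ^ 2 * (4 * L / (δ ^ 3 * r ^ 4)) := mul_le_mul hρ2 hΦ hΦ0 (by positivity)
    have t3 : σ₀ ^ 2 * Du / r ^ 2 ≤ (r / L ^ 70) * (L ^ 30 * ε + L ^ 250 / (δ ^ 3 * r ^ 2)) / r ^ 2 :=
      div_le_div_of_nonneg_right (mul_le_mul hρ₀hi hDu hDu0 (by positivity)) (by positivity)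
    set C := 1 / (δ ^ 3 * r ^ 2) with hC
    have hC0 : 0 ≤ C := by positivity
    have f2 : (r / L ^ 70) ^ 2 * (4 * L / (δ ^ 3 * r ^ 4)) = (4 * L / L ^ 140) * C := by rw [hC]; field_simp
    have f3 : (r / L ^ 70) * (L ^ 30 * ε + L ^ 250 / (δ ^ 3 * r ^ 2)) / r ^ 2 =
        (L ^ 30 / L ^ 70 * (1 / r)) * ε + (L ^ 250 / L ^ 70 * (1 / r)) * C := by rw [hC]; field_simp
    have fV : ε / L ^ 59 + L ^ 166 / (δ ^ 3 * r ^ 2) = (1 / L ^ 59) * ε + L ^ 166 * C := by rw [hC]; ring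
    have gV : ε / L ^ 58 + L ^ 167 / (δ ^ 3 * r ^ 2) = (1 / L ^ 58) * ε + L ^ 167 * C := by rw [hC]; ring
    rw [gV]; rw [fV] at hGV
    have h2r : 1 / r ≤ 1 := by rw [div_le_one hr0]; exact hr1
    have c6 : 4 * L / L ^ 140 ≤ 1 := by
      rw [div_le_one (by positivity)]
      calc 4 * L ≤ L * L := mul_le_mul_of_nonneg_right (by linarith) hL0.le
        _ = L ^ 2 := by ring
        _ ≤ L ^ 140 := pow_le_pow_right₀ hL1 (by norm_num)
    have c7 : L ^ 30 / L ^ 70 * (1 / r) ≤ 1 / L ^ 59 := by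
      have e : L ^ 30 / L ^ 70 = 1 / L ^ 40 := by
        rw [div_eq_div_iff (by positivity) (by positivity)]; ring
      rw [e]
      calc 1 / L ^ 40 * (1 / r) ≤ 1 / L ^ 40 * (1 / L ^ 400) := by
            refine mul_le_mul_of_nonneg_left (one_div_le_one_div_of_le (by positivity) hr) (by positivity)
        _ = 1 / L ^ 440 := by rw [one_div_mul_one_div, ← pow_add]
        _ ≤ 1 / L ^ 59 := one_div_le_one_div_of_le (by positivity) (pow_le_pow_right₀ hL1 (by norm_num))
    have c8 : L ^ 250 / L ^ 70 * (1 / r) ≤ L ^ 166 := by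
      have e : L ^ 250 / L ^ 70 = L ^ 180 := by rw [div_eq_iff (by positivity)]; ring
      rw [e]
      calc L ^ 180 * (1 / r) ≤ L ^ 180 * (1 / L ^ 400) :=
            mul_le_mul_of_nonneg_left (one_div_le_one_div_of_le (by positivity) hr) (by positivity)
        _ = L ^ 180 / L ^ 400 := by ring
        _ ≤ 1 := by rw [div_le_one (by positivity)]; exact pow_le_pow_right₀ hL1 (by norm_num)
        _ ≤ L ^ 166 := one_le_pow₀ hL1
    have k1 : 2 * (1 / L ^ 59) + 2 * (1 / L ^ 59) ≤ 1 / L ^ 58 := by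
      rw [show 2 * (1 / L ^ 59) + 2 * (1 / L ^ 59) = 4 / L ^ 59 by ring, div_le_div_iff₀ (by positivity) (by positivity), one_mul]
      calc 4 * L ^ 58 ≤ L * L ^ 58 := mul_le_mul_of_nonneg_right (by linarith) (by positivity)
        _ = L ^ 59 := by ring
    have k2 : 2 * L ^ 166 + 2 + 2 * L ^ 166 ≤ L ^ 167 := by
      have : (2 : ℝ) ≤ L ^ 166 := le_trans (by linarith) (le_self_pow₀ hL1 (by norm_num))
      calc 2 * L ^ 166 + 2 + 2 * L ^ 166 ≤ 5 * L ^ 166 := by linarith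
        _ ≤ L * L ^ 166 := mul_le_mul_of_nonneg_right (by linarith) (by positivity)
        _ = L ^ 167 := by ring
    have s1 := mul_le_mul_of_nonneg_right c6 hC0
    have s2 := mul_le_mul_of_nonneg_right c7 hε0
    have s3 := mul_le_mul_of_nonneg_right c8 hC0
    have s4 := mul_le_mul_of_nonneg_right k1 hε0
    have s5 := mul_le_mul_of_nonneg_right k2 hC0
    linarith [hGV, t2, t3, f2, f3, s1, s2, s3, s4, s5]
  exact ⟨hU, hUm, hV⟩

end Summit.AtomisticToContinuum.Crystallization.Theorems.ExcessDecayLiouville
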